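import Summits.BirchSwinnertonDyer.BirchSwinnertonDyer.Theorems.CMKolyvaginAtInertTwoPairMemberOneAtTwo
import Summits.BirchSwinnertonDyer.BirchSwinnertonDyer.Theorems.CMKolyvaginAtInertTwoPairMemberTwoAtTwo
import Summits.BirchSwinnertonDyer.BirchSwinnertonDyer.Theorems.CMKolyvaginAtInertTwoPairMemberHlocAtTwo
import Summits.BirchSwinnertonDyer.BirchSwinnertonDyer.Theorems.GenusKolyvaginAtTwoVisiblePairAtTwoCasselsTateShaThree
import Literature.NumberTheory.GaloisCohomology.PoitouTateNumberField
import Literature.NumberTheory.EllipticCurves.SelmerTorsionExactDescentProofs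
import HarnessLib

/-!
# Route `CMKolyvaginAtInertTwo`, crux `CMKolyvaginExactAtInertTwo` (stmt-BirchSwinnertonDyer-24277):
# T2 input (iii) ASSEMBLED — the two Cassels–Tate MEMBER FORMULAS over `ℚ` at `2` for the CANONICAL
# pairing data, record-free: McCallum's Prop. 4.7 + Lemma 5.3 for `E` and for `E^{(d_K)}`, modulo only
# displayed class data (`c₁`, `c₂`, Lemma 4.3, Prop. 4.4 across the members) and the annihilator `hkill`

Seat `bsd-line-cmk2-p1` g16 (cell `bsd-print-cf2`); helper (`--supports stmt-BirchSwinnertonDyer-24277`).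
THEOREMS ONLY: no definition, no named fact, no `sorry`; no item is closed; BSD is not proved by this.

`hV₁_of_localTerm_of_kill` / `hV₂_of_localTerm_of_kill` (this seat, gk2-p2's member formulas re-based)
display McCallum's Lemma 5.3 at `λ` (`hloc₁`/`hloc₂`) for arbitrary local invariants; `hloc₁/₂_canonical_of_rel`
discharge them for THE invariant maps. Here the two are composed, with Tate's reciprocity
(`sumInvLocalizationEqZero_canonical_of_numberField`) and `Ш³(ℚ, μ) = 0` (`VisiblePairAtTwo.shaThree_mu_eq_zero`,
p669505) supplied: the member formulas `hV₁`, `hV₂` that `KolyvaginPairDataTwo.hCTV_of_members` (p691010) and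
the telescope `card_mul_card_le_two_pow_two_mul_of_injective` (p690708) consume, GRANTED ONLY: the classes
`c₁`, `c₂` with Lemma 4.3 over `ℚ` and Prop. 4.4 across the members (point-system / Q2 data), the habitat
(`Δ < 0`, `ρ̄₂` onto, `K` imaginary quadratic, `d_K` odd), `hkill` (finiteness of the two `Ш[2^∞]` with `L`
large), a Weil pairing on `E[2^{2L}]` resp. `E^{(d_K)}[2^{2L}]` (tree: `exists_weilPairing_holds`) and the maps
`ι₁`, `ι₂` into `Ш[2^L]` (`VisiblePairAtTwo.exists_selmerToSha`). No `Input` record, no `sel_visible`, no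
`cebotarev`.

* `hV₁_canonical_of_kill`, `hV₂_canonical_of_kill`.

References: [McCallumLMS1991] §4 Prop. 4.4, 4.7, §5 Lemma 5.3, Thm. 5.4; [MilneADT2006] I Thm. 4.10, §6 Prop. 6.9.
-/

set_option linter.dupNamespace false -- tree convention: `Summit.BirchSwinnertonDyer.BirchSwinnertonDyer.Theorems` (summit = sub-problem)
set_option autoImplicit false

noncomputable section

open scoped Classical
open scoped AddSubgroup

universe u

namespace Summit.BirchSwinnertonDyer.BirchSwinnertonDyer.Theorems.KolyvaginPairDataTwo

open WeierstrassCurve NumberField IsDedekindDomain Field Function Rat.HeightOneSpectrum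
open Literature.NumberTheory.EllipticCurves Literature.NumberTheory.GaloisRepresentations
open Literature.NumberTheory.GaloisCohomology
open Literature.NumberTheory.GaloisRepresentations.DiscreteGaloisModule (mu)
open Literature.NumberTheory.EllipticCurves.KolyvaginDescent
open Literature.GroupTheory.FiniteAbelian
open Summit.BirchSwinnertonDyer.BirchSwinnertonDyer.Theorems.GenusExact.VisiblePairAtTwo

/-! ## The annihilator input `hkill` from FINITENESS (no Kolyvagin annihilator, no Čebotarev) -/

section Kill

/-- **`hkill` from finiteness**: for a subgroup `S` of an additive group with `S` finite and
`v₂(#S) ≤ L`, every `a ∈ S` killed by `2^{2L}` is killed by `2^L` (its order is a power of `2` dividing `#S`).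
On `H₂` (modulo GZ/GZK/modularity) `Ш(E/ℚ)` and `Ш(E^{(d_K)}/ℚ)` are finite (seat g15's
`ShaCountTwo.rank_add_eq_one_and_finite_sha_of_heegnerData_of_facts`), so the displayed `hkill` of the member
formulas holds for every `L ≥ v₂(#Ш)`. [folklore] -/
theorem zsmul_pow_eq_zero_of_finite_of_padicValNat_le {G : Type*} [AddCommGroup G] (S : AddSubgroup G)
    [Finite S] {L : ℕ} (hL : padicValNat 2 (Nat.card S) ≤ L) :
    ∀ a ∈ S, ((2 : ℤ) ^ (2 * L)) • a = 0 → ((2 : ℤ) ^ L) • a = 0 := by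
  intro a ha h2L
  -- the order of `⟨a, ha⟩ : S` is a power of `2` dividing `#S`
  have hcard : addOrderOf (⟨a, ha⟩ : S) ∣ Nat.card S := addOrderOf_dvd_natCard _
  have hpow : addOrderOf (⟨a, ha⟩ : S) ∣ 2 ^ (2 * L) := by
    rw [addOrderOf_dvd_iff_nsmul_eq_zero]
    apply Subtype.ext
    rw [AddSubgroupClass.coe_nsmul, ZeroMemClass.coe_zero, ← natCast_zsmul]
    push_cast
    exact h2L
  obtain ⟨k, -, hk⟩ := (Nat.dvd_prime_pow Nat.prime_two).mp hpow
  have hkv : k ≤ padicValNat 2 (Nat.card S) := by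
    have hne : Nat.card S ≠ 0 := Nat.card_pos.ne'
    have := hcard
    rw [hk] at this
    exact (padicValNat_dvd_iff_le hne).mp this
  have hord : ((2 : ℤ) ^ k) • a = 0 := by
    have h := addOrderOf_nsmul_eq_zero (⟨a, ha⟩ : S)
    rw [hk] at h
    have h' := congrArg Subtype.val h
    rw [AddSubgroupClass.coe_nsmul, ZeroMemClass.coe_zero, ← natCast_zsmul] at h'
    push_cast at h'
    exact h'
  rw [show L = (L - k) + k by omega, pow_add, mul_smul, hord, smul_zero]

/-- **The maps `ι : Sel_{2^{2L}}(A/F) → Ш(A/F)[2^L]` exist as soon as `Ш(A/F)` is FINITE with `v₂(#Ш) ≤ L`**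
(`VisiblePairAtTwo.exists_selmerToSha` fed by `zsmul_pow_eq_zero_of_finite_of_padicValNat_le`: the image of a
`2^{2L}`-Selmer class in `H¹(F, A)` lies in `Ш` and is killed by `2^{2L}`, hence by `2^L`). On `H₂` this gives
the binders `ι₁`, `ι₂` of `hV₁/hV₂_canonical_of_kill` from seat g15's finiteness of `Ш(E/ℚ)`, `Ш(E^{(d_K)}/ℚ)`.
[cite: MilneADT2006, Ch. I §6, (6.14) and Prop. 6.9] -/
theorem exists_selmerToSha_of_finite {F : Type} [Field F] [NumberField F] (A : WeierstrassCurve F) [A.IsElliptic]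
    [Finite A.sha] {L : ℕ} (hL : padicValNat 2 (Nat.card A.sha) ≤ L) :
    ∃ ι : selmerGroup A (lvl (L + L)) →+ (A.sha)[(2 ^ L : ℕ)],
      ∀ z, shaTorsionVal A (2 ^ L) (ι z) = torsionH1ToH1 A (lvl (L + L)) z := by
  refine exists_selmerToSha A (L + L) L fun z hz ↦ ?_
  have hmem : torsionH1ToH1 A (lvl (L + L)) z ∈ A.sha :=
    torsionH1ToH1_mem_sha_of_mem_selmerGroup (W := A) (lvl_ne_zero (L + L)) hz
  refine zsmul_pow_eq_zero_of_finite_of_padicValNat_le A.sha hL _ hmem ?_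
  have h := zsmul_torsionH1ToH1_eq_zero (W := A) (n := lvl (L + L)) z
  have hlvl : (lvl (L + L) : ℤ) = (2 : ℤ) ^ (2 * L) := by
    change ((2 ^ (L + L) : ℕ) : ℤ) = _
    push_cast
    rw [two_mul]
  have heq : ((2 : ℤ) ^ (2 * L)) • torsionH1ToH1 A (lvl (L + L)) z =
      (lvl (L + L) : ℤ) • torsionH1ToH1 A (lvl (L + L)) z :=
    congrArg (fun c : ℤ ↦ c • torsionH1ToH1 A (lvl (L + L)) z) hlvl.symm
  rw [heq]
  exact h

end Kill

section Canonical

variable {W : WeierstrassCurve ℚ} [W.IsElliptic] [W.IsGloballyMinimal] {K : Type} [Field K] [NumberField K]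
  {L : ℕ} [(twin W K).IsElliptic] [NeZero (2 ^ L * 2 ^ L)]

/-- **The member formula `hV₁` for THE Cassels–Tate pairing of `E` at level `2^L`, record-free** (McCallum
Prop. 4.7 + Lemma 5.3 over `ℚ` at `2`): `hV₁_of_localTerm_of_kill` ∘ `hloc₁_canonical_of_rel` with Tate's
reciprocity and `Ш³(ℚ, μ) = 0` supplied. [cite: McCallumLMS1991, §4 Prop. 4.7, §5 Lemma 5.3, Thm. 5.4 (proof)]
[cite: MilneADT2006, Ch. I Thm. 4.10 and §6 Prop. 6.9] -/
theorem hV₁_canonical_of_kill {M₀ : ℕ} (c₁ : ℕ → galH1Torsion W (lvl (L + L)))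
    (c₂ : ℕ → galH1Torsion (twin W K) (lvl (L + L))) (hΔ : W.Δ < 0)
    (hρ2 : W.HasSurjectiveModNGaloisRep 2) (hL : 2 * M₀ ≤ L) (hL1 : 1 ≤ L)
    (hkill : ∀ a ∈ W.sha, ((2 : ℤ) ^ (2 * L)) • a = 0 → ((2 : ℤ) ^ L) • a = 0)
    (loc_c₁_fin : ∀ m, KolSupp (kolPrime W K (L + L)) m → Even m.primeFactors.card →
      ∀ v : HeightOneSpectrum (𝓞 ℚ), (m : 𝓞 ℚ) ∉ v.asIdeal → c₁ m ∈ selmerLocalKer W (v.adicCompletion ℚ) (lvl (L + L)))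
    (loc_c₁_inf : ∀ m, KolSupp (kolPrime W K (L + L)) m → Even m.primeFactors.card →
      ∀ w : InfinitePlace ℚ, c₁ m ∈ selmerLocalKer W w.Completion (lvl (L + L)))
    (h44₂₁ : ∀ ℓ m : ℕ, kolPrime W K (L + L) ℓ → KolSupp (kolPrime W K (L + L)) (ℓ * m) →
      Odd m.primeFactors.card → ∀ a : ℕ,
        ((2 : ℤ) ^ a) • c₁ (ℓ * m) ∈ loc₁ W (L + L) (pl ℓ) ↔ ((2 : ℤ) ^ a) • c₂ m ∈ a₂ W K (L + L) ℓ)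
    (e : geomTorsion W ((2 ^ L * 2 ^ L : ℕ) : ℤ) → geomTorsion W ((2 ^ L * 2 ^ L : ℕ) : ℤ) → AlgebraicClosure ℚ)
    (hμ : ∀ S T, e S T ^ (2 ^ L * 2 ^ L) = 1)
    (hadd₁ : ∀ S₁ S₂ T, e (S₁ + S₂) T = e S₁ T * e S₂ T)
    (hadd₂ : ∀ S T₁ T₂, e S (T₁ + T₂) = e S T₁ * e S T₂)
    (hgal : ∀ (σ : absoluteGaloisGroup ℚ) (S T : geomTorsion W ((2 ^ L * 2 ^ L : ℕ) : ℤ)),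
      σ • e S T = e (σ • S) (σ • T))
    (halt : ∀ T, e T T = 1) (hnondeg : ∀ T, (∀ S, e S T = 1) → T = 0)
    (ι₁ : selmerGroup W (lvl (L + L)) →+ (W.sha)[(2 ^ L : ℕ)])
    (hι₁ : ∀ z, shaTorsionVal W (2 ^ L) (ι₁ z) = torsionH1ToH1 W (lvl (L + L)) z) :
    ∀ ℓ m' : ℕ, kolPrime W K (L + L) ℓ → KolSupp (kolPrime W K (L + L)) (ℓ * m') → ¬ ℓ ∣ m' →
      Odd m'.primeFactors.card →
      ∀ (j N a b : ℕ) (t : galH1Torsion W (lvl (L + L))) (ht : t ∈ selmerGroup W (lvl (L + L)))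
        (hz : ((2 : ℤ) ^ j) • c₁ (ℓ * m') ∈ selmerGroup W (lvl (L + L))),
      ((2 : ℤ) ^ N) • t = 0 → ((2 : ℤ) ^ (2 * M₀)) • t = 0 →
      (∀ q ∈ m'.primeFactors, t ∈ a₁ W (L + L) q) → L + L - M₀ ≤ j →
      N + M₀ ≤ L + L → N ≤ j → a + b + 1 = N →
      ((2 : ℤ) ^ (a + (j - N))) • c₂ m' ∉ a₂ W K (L + L) ℓ →
      ((2 : ℤ) ^ b) • t ∉ a₁ W (L + L) ℓ →
      ((ctLevelPairing W (2 ^ L) e hμ hadd₁ hadd₂ hgal (LocalInvariants.canonical ℚ (2 ^ L * 2 ^ L)) halt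
        (sumInvLocalizationEqZero_canonical_of_numberField ℚ (2 ^ L * 2 ^ L)) (shaThree_mu_eq_zero ℚ (2 ^ L * 2 ^ L))
        (localTerm_finite_support (W := W) (m := 2 ^ L) (e := e) (hμ := hμ) (hadd₁ := hadd₁) (hadd₂ := hadd₂)
          (hgal := hgal) halt (LocalInvariants.canonical ℚ (2 ^ L * 2 ^ L)))).comp ι₁).compl₂ ι₁ ⟨_, hz⟩ ⟨t, ht⟩ ≠ 0 := by
  exact hV₁_of_localTerm_of_kill c₁ c₂ hΔ hρ2 hL hkill loc_c₁_fin loc_c₁_inf e hμ hadd₁ hadd₂ hgal halt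
    (LocalInvariants.canonical ℚ (2 ^ L * 2 ^ L))
    (sumInvLocalizationEqZero_canonical_of_numberField ℚ (2 ^ L * 2 ^ L))
    (shaThree_mu_eq_zero ℚ (2 ^ L * 2 ^ L)) ι₁ hι₁
    (hloc₁_canonical_of_rel c₁ c₂ hΔ (by omega) hL1 h44₂₁ e hμ hadd₁ hadd₂ hgal halt hnondeg)

/-- **The member formula `hV₂` for THE Cassels–Tate pairing of `E^{(d_K)}` at level `2^L`, record-free**:
`hV₂_of_localTerm_of_kill` ∘ `hloc₂_canonical_of_rel` with Tate's reciprocity and `Ш³(ℚ, μ) = 0` supplied.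
[cite: McCallumLMS1991, §4 Prop. 4.7, §5 Lemma 5.3, Thm. 5.4 (proof)] [cite: MilneADT2006, Ch. I Thm. 4.10 and §6 Prop. 6.9] -/
theorem hV₂_canonical_of_kill {M₀ : ℕ} (c₁ : ℕ → galH1Torsion W (lvl (L + L)))
    (c₂ : ℕ → galH1Torsion (twin W K) (lvl (L + L))) (hK : IsImaginaryQuadratic K)
    (hoddK : Odd (NumberField.discr K)) (hΔ : W.Δ < 0)
    (hρ2 : W.HasSurjectiveModNGaloisRep 2) (hL : 2 * M₀ ≤ L) (hL1 : 1 ≤ L)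
    (hkill : ∀ a ∈ (twin W K).sha, ((2 : ℤ) ^ (2 * L)) • a = 0 → ((2 : ℤ) ^ L) • a = 0)
    (loc_c₂_fin : ∀ m, KolSupp (kolPrime W K (L + L)) m → Odd m.primeFactors.card →
      ∀ v : HeightOneSpectrum (𝓞 ℚ), (m : 𝓞 ℚ) ∉ v.asIdeal →
        c₂ m ∈ selmerLocalKer (twin W K) (v.adicCompletion ℚ) (lvl (L + L)))
    (loc_c₂_inf : ∀ m, KolSupp (kolPrime W K (L + L)) m → Odd m.primeFactors.card →
      ∀ w : InfinitePlace ℚ, c₂ m ∈ selmerLocalKer (twin W K) w.Completion (lvl (L + L)))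
    (h44₁₂ : ∀ ℓ m : ℕ, kolPrime W K (L + L) ℓ → KolSupp (kolPrime W K (L + L)) (ℓ * m) →
      Even m.primeFactors.card → ∀ a : ℕ,
        ((2 : ℤ) ^ a) • c₂ (ℓ * m) ∈ loc₂ W K (L + L) (pl ℓ) ↔ ((2 : ℤ) ^ a) • c₁ m ∈ a₁ W (L + L) ℓ)
    (e : geomTorsion (twin W K) ((2 ^ L * 2 ^ L : ℕ) : ℤ) → geomTorsion (twin W K) ((2 ^ L * 2 ^ L : ℕ) : ℤ) →
      AlgebraicClosure ℚ)
    (hμ : ∀ S T, e S T ^ (2 ^ L * 2 ^ L) = 1)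
    (hadd₁ : ∀ S₁ S₂ T, e (S₁ + S₂) T = e S₁ T * e S₂ T)
    (hadd₂ : ∀ S T₁ T₂, e S (T₁ + T₂) = e S T₁ * e S T₂)
    (hgal : ∀ (σ : absoluteGaloisGroup ℚ) (S T : geomTorsion (twin W K) ((2 ^ L * 2 ^ L : ℕ) : ℤ)),
      σ • e S T = e (σ • S) (σ • T))
    (halt : ∀ T, e T T = 1) (hnondeg : ∀ T, (∀ S, e S T = 1) → T = 0)
    (ι₂ : selmerGroup (twin W K) (lvl (L + L)) →+ ((twin W K).sha)[(2 ^ L : ℕ)])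
    (hι₂ : ∀ z, shaTorsionVal (twin W K) (2 ^ L) (ι₂ z) = torsionH1ToH1 (twin W K) (lvl (L + L)) z) :
    ∀ ℓ m' : ℕ, kolPrime W K (L + L) ℓ → KolSupp (kolPrime W K (L + L)) (ℓ * m') → ¬ ℓ ∣ m' →
      Even m'.primeFactors.card →
      ∀ (j N a b : ℕ) (t : galH1Torsion (twin W K) (lvl (L + L))) (ht : t ∈ selmerGroup (twin W K) (lvl (L + L)))
        (hz : ((2 : ℤ) ^ j) • c₂ (ℓ * m') ∈ selmerGroup (twin W K) (lvl (L + L))),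
      ((2 : ℤ) ^ N) • t = 0 → ((2 : ℤ) ^ (2 * M₀)) • t = 0 →
      (∀ q ∈ m'.primeFactors, t ∈ a₂ W K (L + L) q) → L + L - M₀ ≤ j →
      N + M₀ ≤ L + L → N ≤ j → a + b + 1 = N →
      ((2 : ℤ) ^ (a + (j - N))) • c₁ m' ∉ a₁ W (L + L) ℓ →
      ((2 : ℤ) ^ b) • t ∉ a₂ W K (L + L) ℓ →
      ((ctLevelPairing (twin W K) (2 ^ L) e hμ hadd₁ hadd₂ hgal (LocalInvariants.canonical ℚ (2 ^ L * 2 ^ L)) halt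
        (sumInvLocalizationEqZero_canonical_of_numberField ℚ (2 ^ L * 2 ^ L)) (shaThree_mu_eq_zero ℚ (2 ^ L * 2 ^ L))
        (localTerm_finite_support (W := twin W K) (m := 2 ^ L) (e := e) (hμ := hμ) (hadd₁ := hadd₁)
          (hadd₂ := hadd₂) (hgal := hgal) halt (LocalInvariants.canonical ℚ (2 ^ L * 2 ^ L)))).comp ι₂).compl₂ ι₂ ⟨_, hz⟩ ⟨t, ht⟩ ≠ 0 := by
  exact hV₂_of_localTerm_of_kill c₁ c₂ hK hoddK hΔ hρ2 hL hkill loc_c₂_fin loc_c₂_inf e hμ hadd₁ hadd₂ hgal halt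
    (LocalInvariants.canonical ℚ (2 ^ L * 2 ^ L))
    (sumInvLocalizationEqZero_canonical_of_numberField ℚ (2 ^ L * 2 ^ L))
    (shaThree_mu_eq_zero ℚ (2 ^ L * 2 ^ L)) ι₂ hι₂
    (hloc₂_canonical_of_rel c₁ c₂ hK hoddK hΔ (by omega) hL1 h44₁₂ e hμ hadd₁ hadd₂ hgal halt hnondeg)

end Canonical

end Summit.BirchSwinnertonDyer.BirchSwinnertonDyer.Theorems.KolyvaginPairDataTwo

end
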